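import Summits.AtomisticToContinuum.Crystallization.Theorems.HullExactificationCascadeRobustBarlowTemplateTransportSteps1
import Summits.AtomisticToContinuum.Crystallization.Theorems.HullExactificationCascadeRobustBarlowTemplateTransportSteps2
import Summits.AtomisticToContinuum.Crystallization.Theorems.HullExactificationCascadeRobustBarlowTemplateTransportSteps3
import Summits.AtomisticToContinuum.Crystallization.Theorems.HullExactificationCascadeRobustBarlowTemplateTransportSteps5
import Summits.AtomisticToContinuum.Crystallization.Theorems.HullExactificationCascadeRobustBarlowTemplateTransportVinv
import Summits.AtomisticToContinuum.Crystallization.Theorems.HullExactificationCascadeRobustBarlowTemplateTransportAttach1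
import Summits.AtomisticToContinuum.Crystallization.Theorems.HullExactificationCascadeRobustBarlowTemplateTransportAttach2
import Summits.AtomisticToContinuum.Crystallization.Theorems.HullExactificationCascadeRobustBarlowTemplateTransportVComm1
import Summits.AtomisticToContinuum.Crystallization.Theorems.HullExactificationCascadeRobustBarlowTemplateTransportVComm2
import Summits.AtomisticToContinuum.Crystallization.Theorems.PalmUnimodularRigidityShellsToBarlowChartTransportComm3
import Summits.AtomisticToContinuum.Crystallization.Theorems.PalmUnimodularRigidityShellsToBarlowChartTransportVComm2

/-!
# Line `registered` (crux `RobustBarlowTemplate`, stmt-AtomisticToContinuum-12088): commutation of `V⁻¹` with `I` and `J` (part 3/3)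

Helper lemmas for `develop_transport` (the geometric half of the development): frames
`⟨x, t₁, t₂, U⟩` read in the scale-relative integer charts `IsZChart` of an everywhere-good
configuration, their transports and the coherence of the resulting development `frameAt`.  The
only metric inputs are the chart transfer lemma `develop_transfer` and `bond_nb_iff`; everything
else is label combinatorics in `ℤ³` (pattern facts `TransportPatterns*` of the sibling crux 9227,
imported verbatim).  All `[folklore]` (HalesDSP2012 §1.3 for the two kissing patterns).

PORT of `PalmUnimodularRigidityShellsToBarlowChartTransportVComm3.lean` of the closed sibling
crux `ShellsToBarlowChart` (stmt-9227) to the SCALE-RELATIVE shell relation `y ∈ shell S x` of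
this crux (in place of the bond window `0 < dist x y ∧ dist x y ≤ 28/25`) and to the
five-argument charts `IsZChart S x P A nbr`; the port rules (conjunct paths,
`bond a b ↦ b ∈ shell S a`, the threaded symmetry hypothesis
`hsy : ∀ x ∈ S, ∀ y ∈ shell S x, x ∈ shell S y` replacing `bond_symm`, `zchart_transfer` /
`zchart_sqNormInt_eq` replacing `sqNormInt_transfer` / `IsZChart.sqNormInt_eq`, the
`open … hiding …` line) are listed under "Port notes" in `…RobustBarlowTemplateTransportSteps1.lean`
(and its extensions in `…TransportSteps6.lean`, `…TransportAttach1.lean`, `…TransportVComm1.lean`).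

## Port notes (this part: `TransportVComm3`)
* the signatures of `VinvStep_Istep_comm`, `VinvStep_Jstep_comm` are parallel to the source with
  `hsy` inserted right after `hch` (their proofs call `Istep_spec`, `Jstep_spec`, `VinvStep_spec`,
  `VinvStep_Istep_pt`, `VinvStep_Istep_back`, `VinvStep_Istep_side`, `VinvStep_Jstep_pt`,
  `attach_lower_I_pos/neg`, which need symmetry); no bond occurs in this part, so the proofs are
  the source proofs verbatim up to the `hsy` threading (no metric constant occurs either);
* the CHART-AGNOSTIC helpers used from the 9227 commutation files — `hregI_of_valid`,
  `hregJ_of_valid` (9227 `Comm1`), `ZFrame.ext'`, `swap_hyps` (9227 `Comm2`), `Istep_swap`,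
  `Istep_swap'`, `Jstep_swap'`, `IinvStep_swap'`, `JinvStep_swap'` (9227 `Comm3`) and
  `VinvStep_swap'` (9227 `VComm2`): pure `OpsDefs` statements, no chart hypothesis — are NOT
  re-proved (the gate forbids restating landed declarations): the 9227 modules
  `…ShellsToBarlowChartTransportComm3` and `…ShellsToBarlowChartTransportVComm2` are imported for
  them.  Nothing chart-dependent of the source's import `Comm3` is used, so the ported
  `…TransportComm3` of this crux is NOT imported (imports: our parts 1, 2, 3, 5, `Vinv`,
  `Attach1`, `Attach2`, `VComm1`, `VComm2` — the latter split into `…VComm2A` / `…VComm2` — and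
  the two 9227 modules); since those make the 9227 `Comm3`, `VComm1`, `VComm2` visible, the
  `open … hiding …` line of our `…TransportVComm1` is EXTENDED by the chart-dependent 9227 names
  redeclared in our `Comm3`, `VComm1`, `VComm2A/2` and here (`Vstep_Istep_comm`, `Vstep_Jstep_comm`,
  `attach_lower_J_pos`, `attach_lower_J_neg`, `VinvStep_Istep_pt`, `VinvStep_Jstep_pt`,
  `VinvStep_Istep_back`, `VinvStep_Istep_side`) — inside this namespace our declarations take
  precedence anyway;
* the anchor at the end (explicit-`∀` form of `VinvStep_Istep_comm`, registered sub-goal) is new.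
-/

noncomputable section

namespace Summit.AtomisticToContinuum.Crystallization.Theorems.HullExactificationCascadeRobustBarlowTemplate

open Literature.Geometry.DiscreteGeometry Literature.MathematicalPhysics.StatisticalMechanics
open Summit.AtomisticToContinuum.Crystallization.Theorems.PalmUnimodularRigidityShellsToBarlowChart hiding
  IsZChart TransportSystem scales_tied sqNormInt_transfer bond_symm nb_mem zlab_spec zlab_nb bond_nb_iff
  pattern_cases transfer_nb_nb transfer_nb_centre transfer_nb_target sqNormInt_zlab_centre hcp_of_mirror_pair
  Istep_spec Jstep_spec IinvStep_spec JinvStep_spec capWithAny_of_mem_cap IinvStep_Istep Istep_IinvStep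
  JinvStep_Jstep Jstep_JinvStep polar_at_apex onesided_at_apex nb_inj Istep_lower Jstep_lower
  IinvStep_lower JinvStep_lower Vstep_spec polar_at_lower_apex onesided_at_lower_apex VinvStep_spec
  attach_I_even attach_I_odd attach_lower_I_pos attach_lower_I_neg attach_J_even attach_J_odd
  Vstep_Istep_pt Vstep_Istep_back Vstep_Istep_side Vstep_Jstep_pt Vstep_Istep_comm Vstep_Jstep_comm
  attach_lower_J_pos attach_lower_J_neg VinvStep_Istep_pt VinvStep_Jstep_pt VinvStep_Istep_back
  VinvStep_Istep_side

variable {S : Set (EuclideanSpace ℝ (Fin 3))} {Pc : (EuclideanSpace ℝ (Fin 3)) → Finset (Fin 3 → ℤ)}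
  {Ac : (EuclideanSpace ℝ (Fin 3)) → ((EuclideanSpace ℝ (Fin 3)) →ₗᵢ[ℝ] (EuclideanSpace ℝ (Fin 3)))} {nb : (EuclideanSpace ℝ (Fin 3)) → (Fin 3 → ℤ) → (EuclideanSpace ℝ (Fin 3))}

/-- **`V⁻¹ ∘ I = I ∘ V⁻¹` (layer `k → k−1` coherence).**  For a valid frame `g` whose layer-`k`
neighbourhood is valid and which commutes with the in-layer steps, the frame transported first
along `t₁` and then down equals the frame transported first down and then along its own `t₁`.
[folklore] -/
theorem VinvStep_Istep_comm (hch : ∀ z ∈ S, IsZChart S z (Pc z) (Ac z) (nb z))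
    (hsy : ∀ x ∈ S, ∀ y ∈ shell S x, x ∈ shell S y) {x : (EuclideanSpace ℝ (Fin 3))} (hx : x ∈ S) {t₁ t₂ : Fin 3 → ℤ} {U : Finset (Fin 3 → ℤ)} (hU : IsFrame (Pc x) t₁ t₂ U) (hI : IsFrame (Pc (nb x t₁)) (Istep Pc nb ⟨x, t₁, t₂, U⟩).t₁ (Istep Pc nb ⟨x, t₁, t₂, U⟩).t₂ (Istep Pc nb ⟨x, t₁, t₂, U⟩).U) (hJ : IsFrame (Pc (nb x t₂)) (Jstep Pc nb ⟨x, t₁, t₂, U⟩).t₁ (Jstep Pc nb ⟨x, t₁, t₂, U⟩).t₂ (Jstep Pc nb ⟨x, t₁, t₂, U⟩).U) (hIi : IsFrame (Pc (nb x (-t₁))) (IinvStep Pc nb ⟨x, t₁, t₂, U⟩).t₁ (IinvStep Pc nb ⟨x, t₁, t₂, U⟩).t₂ (IinvStep Pc nb ⟨x, t₁, t₂, U⟩).U) (hJi : IsFrame (Pc (nb x (-t₂))) (JinvStep Pc nb ⟨x, t₁, t₂, U⟩).t₁ (JinvStep Pc nb ⟨x, t₁, t₂, U⟩).t₂ (JinvStep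 Pc nb ⟨x, t₁, t₂, U⟩).U) (hII : IsFrame (Pc (nb (nb x t₁) (Istep Pc nb ⟨x, t₁, t₂, U⟩).t₁)) (Istep Pc nb (Istep Pc nb ⟨x, t₁, t₂, U⟩)).t₁ (Istep Pc nb (Istep Pc nb ⟨x, t₁, t₂, U⟩)).t₂ (Istep Pc nb (Istep Pc nb ⟨x, t₁, t₂, U⟩)).U) (hJI : IsFrame (Pc (nb (nb x t₁) (Istep Pc nb ⟨x, t₁, t₂, U⟩).t₂)) (Jstep Pc nb (Istep Pc nb ⟨x, t₁, t₂, U⟩)).t₁ (Jstep Pc nb (Istep Pc nb ⟨x, t₁, t₂, U⟩)).t₂ (Jstep Pc nb (Istep Pc nb ⟨x, t₁, t₂, U⟩)).U) (hIiI : IsFrame (Pc (nb (nb x t₁) (-(Istep Pc nb ⟨x, t₁, t₂, U⟩).t₁))) (IinvStep Pc nb (Istep Pc nb ⟨x, t₁, t₂, U⟩)).t₁ (IinvStep Pc nb (Istep Pc nb ⟨x, t₁, t₂, U⟩)).t₂ (IinvStep Pc nb (Istep Pc nb ⟨x, t₁, t₂, U⟩)).U) (hJiI : IsFrame (Pc (nb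 (nb x t₁) (-(Istep Pc nb ⟨x, t₁, t₂, U⟩).t₂))) (JinvStep Pc nb (Istep Pc nb ⟨x, t₁, t₂, U⟩)).t₁ (JinvStep Pc nb (Istep Pc nb ⟨x, t₁, t₂, U⟩)).t₂ (JinvStep Pc nb (Istep Pc nb ⟨x, t₁, t₂, U⟩)).U) (hcomm : Istep Pc nb (Jstep Pc nb ⟨x, t₁, t₂, U⟩) = Jstep Pc nb (Istep Pc nb ⟨x, t₁, t₂, U⟩)) : VinvStep Pc nb (Istep Pc nb ⟨x, t₁, t₂, U⟩) = Istep Pc nb (VinvStep Pc nb ⟨x, t₁, t₂, U⟩) := by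
  have hregI := hregI_of_valid (Pc := Pc) (nb := nb) hI
  obtain ⟨hyS, hbxy, hwP, hwx, -, -, -, -, -, -, -, hframe, hparI, -⟩ := Istep_spec hch hsy hx hU hregI
  obtain ⟨hd'L, hdS, hbd, hξP, hξx, hframeVi, -, hbr⟩ := VinvStep_spec hch hsy hx hU hI hJ hIi hJi
  obtain ⟨hpt, hbdd₁, -⟩ := VinvStep_Istep_pt hch hsy hx hU hI hJ hIi hJi
  obtain ⟨hα, -⟩ := VinvStep_Istep_back hch hsy hx hU hI hJ hIi hJi hII hJI hIiI hJiI
  obtain ⟨hβ, -⟩ := VinvStep_Istep_side hch hsy hx hU hI hJ hIi hJi hII hJI hIiI hJiI hcomm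
  obtain ⟨hptJ, -, -⟩ := VinvStep_Jstep_pt hch hsy hx hU hI hJ hIi hJi
  have hPx := pattern_cases hch hx
  have hPy := pattern_cases hch hyS
  have hPd := pattern_cases hch hdS
  obtain ⟨h12, hhex, hUP, -, -⟩ := id hU
  have ht₁ : t₁ ∈ Pc x := hhex (mem_hexLabels_iff.2 (Or.inl rfl))
  have ht₂ : t₂ ∈ Pc x := hhex (mem_hexLabels_iff.2 (Or.inr (Or.inl rfl)))
  -- canonical names at `x`: `d', d, τ₁, τ₂, Ud`
  set d' := apexOf t₁ t₂ (lowerCap (Pc x) t₁ t₂ U) with hd'_def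
  have hd'P : d' ∈ Pc x := (mem_lowerCap_iff.1 hd'L).1
  have hVpt : (VinvStep Pc nb ⟨x, t₁, t₂, U⟩).pt = nb x d' := rfl
  rw [hVpt] at *
  set d := nb x d' with hd_def
  set τ₁ := (VinvStep Pc nb ⟨x, t₁, t₂, U⟩).t₁ with hτ₁_def
  set τ₂ := (VinvStep Pc nb ⟨x, t₁, t₂, U⟩).t₂ with hτ₂_def
  set Ud := (VinvStep Pc nb ⟨x, t₁, t₂, U⟩).U with hUd_def
  have hVeq : VinvStep Pc nb ⟨x, t₁, t₂, U⟩ = ⟨d, τ₁, τ₂, Ud⟩ := rfl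
  obtain ⟨h12d, hhexd, hUdP, hoffd, -⟩ := id hframeVi
  have hτ₁P : τ₁ ∈ Pc d := hhexd (mem_hexLabels_iff.2 (Or.inl rfl))
  have hτ₂P : τ₂ ∈ Pc d := hhexd (mem_hexLabels_iff.2 (Or.inr (Or.inl rfl)))
  -- the frame `I g = ⟨y, a', b', U'⟩`
  set a' := (Istep Pc nb ⟨x, t₁, t₂, U⟩).t₁ with ha'
  set b' := (Istep Pc nb ⟨x, t₁, t₂, U⟩).t₂ with hb'
  set U' := (Istep Pc nb ⟨x, t₁, t₂, U⟩).U with hU'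
  have hIeq : Istep Pc nb ⟨x, t₁, t₂, U⟩ = ⟨nb x t₁, a', b', U'⟩ := rfl
  rw [hIeq] at hII hJI hIiI hJiI hpt hbdd₁ hα hβ ⊢
  obtain ⟨hdL'L, hd₁S, hbyd₁, hξ'P, hξ'y, hframeVi', -, hbr'⟩ :=
    VinvStep_spec hch hsy hyS hframe hII hJI hIiI hJiI
  set dL' := apexOf a' b' (lowerCap (Pc (nb x t₁)) a' b' U') with hdL'_def
  have hdL'P : dL' ∈ Pc (nb x t₁) := (mem_lowerCap_iff.1 hdL'L).1
  have hV'pt : (VinvStep Pc nb ⟨nb x t₁, a', b', U'⟩).pt = nb (nb x t₁) dL' := rfl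
  rw [hV'pt] at *
  set d₁ := nb (nb x t₁) dL' with hd₁_def
  set τ₁'' := (VinvStep Pc nb ⟨nb x t₁, a', b', U'⟩).t₁ with hτ₁''_def
  set τ₂'' := (VinvStep Pc nb ⟨nb x t₁, a', b', U'⟩).t₂ with hτ₂''_def
  set U₁ := (VinvStep Pc nb ⟨nb x t₁, a', b', U'⟩).U with hU₁_def
  have hV'eq : VinvStep Pc nb ⟨nb x t₁, a', b', U'⟩ = ⟨d₁, τ₁'', τ₂'', U₁⟩ := rfl
  have hPd₁ := pattern_cases hch hd₁S
  obtain ⟨h12'', hhex'', -, -, -⟩ := id hframeVi'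
  have hτ₁''P : τ₁'' ∈ Pc d₁ := hhex'' (mem_hexLabels_iff.2 (Or.inl rfl))
  have hτ12''P : τ₁'' - τ₂'' ∈ Pc d₁ :=
    hhex'' (mem_hexLabels_iff.2 (Or.inr (Or.inr (Or.inr (Or.inr (Or.inr rfl))))))
  -- the three identifications
  have hd₁' : nb d τ₁ = d₁ := hpt.symm
  have hw' : zlab Pc nb d₁ d = -τ₁'' := hα
  rw [hVeq] at hptJ
  have hdJ : nb d τ₂ = (VinvStep Pc nb (Jstep Pc nb ⟨x, t₁, t₂, U⟩)).pt := hptJ.symm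
  have hv' : zlab Pc nb d₁ (nb d τ₂) = τ₂'' - τ₁'' := by rw [hdJ]; exact hβ
  -- the I-step of `V⁻¹ g` (layer `k−1`)
  have hreg3 : Pc (nb d τ₁) = fcc3Int ∨ Pc d = hcpInt ∨
      (-zlab Pc nb (nb d τ₁) d ∈ Pc (nb d τ₁) ∧ -zlab Pc nb (nb d τ₁) (nb d τ₂) ∈ Pc (nb d τ₁)) := by
    refine Or.inr (Or.inr ⟨?_, ?_⟩)
    · rw [hd₁', hw', neg_neg]; exact hτ₁''P
    · rw [hd₁', hv', neg_sub]; exact hτ12''P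
  obtain ⟨-, -, -, -, -, -, -, -, -, -, -, -, -, c₁, hc₁U, -, hfilt₁, hbur, hrU, hUeq₂, -⟩ :=
    Istep_spec hch hsy hdS hframeVi hreg3
  have ept : (Istep Pc nb ⟨d, τ₁, τ₂, Ud⟩).pt = d₁ := hd₁'
  have e₁ : (Istep Pc nb ⟨d, τ₁, τ₂, Ud⟩).t₁ = τ₁'' := by
    show -zlab Pc nb (nb d τ₁) d = τ₁''
    rw [hd₁', hw', neg_neg]
  have e₂ : (Istep Pc nb ⟨d, τ₁, τ₂, Ud⟩).t₂ = τ₂'' := by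
    show zlab Pc nb (nb d τ₁) (nb d τ₂) - zlab Pc nb (nb d τ₁) d = τ₂''
    rw [hd₁', hv', hw']; abel
  rw [hd₁'] at hbur hrU hUeq₂
  rw [e₁, e₂] at hUeq₂
  -- the transported reference `r = zlab d₁ (nb d c₁)` is the label of `x` (letter `+1`) or of `Ix`
  -- (letter `−1`) at `d₁`, hence lies in `U₁`
  have hrU₁ : zlab Pc nb d₁ (nb d c₁) ∈ U₁ := by
    have hξoff : zlab Pc nb d x ∉ hexLabels τ₁ τ₂ := by
      rcases hbr with ⟨-, hUd, -, -, -⟩ | ⟨-, hUd, -, -, -⟩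
      · exact hoffd _ (by rw [hUd]; simp)
      · exact hoffd _ (by rw [hUd]; simp)
    rcases hbr with ⟨hlp, hUd, hnI, -, -⟩ | ⟨hlp, hUd, hnI, -, -⟩
    · -- `Ud = {ξ, ξ − τ₁, ξ − τ₂}`: the element touching `τ₁` is `ξ`, so `nb d c₁ = x`
      have hx1 : zlab Pc nb d x - τ₁ ∈ Pc d := hUdP (by rw [hUd]; simp)
      have hx2 : zlab Pc nb d x - τ₂ ∈ Pc d := hUdP (by rw [hUd]; simp)
      have hc₁ : c₁ = zlab Pc nb d x := by
        have h1 := (filter_evenCap (Pc d) hPd τ₁ hτ₁P τ₂ hτ₂P _ hξP h12d hhexd hξoff hx1 hx2).1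
        rw [← hUd, hfilt₁] at h1
        exact Finset.singleton_injective h1
      rw [hc₁, hξx]
      -- `x` has label `ξ' − τ₁''` at `d₁`
      rcases hbr' with ⟨-, hUd₁, hnI', -, -⟩ | ⟨hlp'', -, -, -, -⟩
      swap
      · obtain ⟨hlp', -, -⟩ := attach_lower_I_pos hch hsy hx hU hlp hregI
        rw [hIeq] at hlp'
        exact absurd (hlp'.symm.trans hlp'') (by norm_num)
      have hyx : nb (nb x t₁) (-a') = x := by
        show nb (nb x t₁) (-(-zlab Pc nb (nb x t₁) x)) = x
        rw [neg_neg]; exact hwx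
      rw [hyx] at hnI'
      have hmem : zlab Pc nb d₁ (nb x t₁) - τ₁'' ∈ U₁ := by rw [hUd₁]; simp
      have hlab : zlab Pc nb d₁ x = zlab Pc nb d₁ (nb x t₁) - τ₁'' := by
        have h := zlab_nb hch hd₁S (hframeVi'.2.2.1 hmem)
        rwa [hnI'] at h
      rw [hlab]; exact hmem
    · -- `Ud = {ξ, ξ + τ₁, ξ + τ₂}`: the element touching `τ₁` is `ξ + τ₁`, so `nb d c₁ = Ix`
      have hx1 : zlab Pc nb d x + τ₁ ∈ Pc d := hUdP (by rw [hUd]; simp)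
      have hx2 : zlab Pc nb d x + τ₂ ∈ Pc d := hUdP (by rw [hUd]; simp)
      have hc₁ : c₁ = zlab Pc nb d x + τ₁ := by
        have h1 := (filter_oddCap (Pc d) hPd τ₁ hτ₁P τ₂ hτ₂P _ hξP h12d hhexd hξoff hx1 hx2).1
        rw [← hUd, hfilt₁] at h1
        exact Finset.singleton_injective h1
      rw [hc₁, hnI]
      rcases hbr' with ⟨hlp'', -, -, -, -⟩ | ⟨-, hUd₁, -, -, -⟩
      · obtain ⟨hlp', -, -⟩ := attach_lower_I_neg hch hsy hx hU hlp hregI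
        rw [hIeq] at hlp'
        exact absurd (hlp'.symm.trans hlp'') (by norm_num)
      rw [hUd₁]; simp
  have hU₂ : (Istep Pc nb ⟨d, τ₁, τ₂, Ud⟩).U = U₁ := by
    rw [hUeq₂]; exact capWithAny_of_mem_cap hch hd₁S hframeVi' hrU₁
  rw [hVeq, hV'eq]
  exact (ZFrame.ext' ept e₁ e₂ hU₂).symm

/-- **`V⁻¹ ∘ J = J ∘ V⁻¹`**, from `VinvStep_Istep_comm` by the swap symmetry. [folklore] -/
theorem VinvStep_Jstep_comm (hch : ∀ z ∈ S, IsZChart S z (Pc z) (Ac z) (nb z))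
    (hsy : ∀ x ∈ S, ∀ y ∈ shell S x, x ∈ shell S y) {x : (EuclideanSpace ℝ (Fin 3))}
    (hx : x ∈ S) {t₁ t₂ : Fin 3 → ℤ} {U : Finset (Fin 3 → ℤ)} (hU : IsFrame (Pc x) t₁ t₂ U)
    (hI : IsFrame (Pc (nb x t₁)) (Istep Pc nb ⟨x, t₁, t₂, U⟩).t₁ (Istep Pc nb ⟨x, t₁, t₂, U⟩).t₂
      (Istep Pc nb ⟨x, t₁, t₂, U⟩).U)
    (hJ : IsFrame (Pc (nb x t₂)) (Jstep Pc nb ⟨x, t₁, t₂, U⟩).t₁ (Jstep Pc nb ⟨x, t₁, t₂, U⟩).t₂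
      (Jstep Pc nb ⟨x, t₁, t₂, U⟩).U)
    (hIi : IsFrame (Pc (nb x (-t₁))) (IinvStep Pc nb ⟨x, t₁, t₂, U⟩).t₁
      (IinvStep Pc nb ⟨x, t₁, t₂, U⟩).t₂ (IinvStep Pc nb ⟨x, t₁, t₂, U⟩).U)
    (hJi : IsFrame (Pc (nb x (-t₂))) (JinvStep Pc nb ⟨x, t₁, t₂, U⟩).t₁
      (JinvStep Pc nb ⟨x, t₁, t₂, U⟩).t₂ (JinvStep Pc nb ⟨x, t₁, t₂, U⟩).U)
    (hJJ : IsFrame (Pc (nb (nb x t₂) (Jstep Pc nb ⟨x, t₁, t₂, U⟩).t₂))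
      (Jstep Pc nb (Jstep Pc nb ⟨x, t₁, t₂, U⟩)).t₁ (Jstep Pc nb (Jstep Pc nb ⟨x, t₁, t₂, U⟩)).t₂
      (Jstep Pc nb (Jstep Pc nb ⟨x, t₁, t₂, U⟩)).U)
    (hIJ : IsFrame (Pc (nb (nb x t₂) (Jstep Pc nb ⟨x, t₁, t₂, U⟩).t₁))
      (Istep Pc nb (Jstep Pc nb ⟨x, t₁, t₂, U⟩)).t₁ (Istep Pc nb (Jstep Pc nb ⟨x, t₁, t₂, U⟩)).t₂
      (Istep Pc nb (Jstep Pc nb ⟨x, t₁, t₂, U⟩)).U)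
    (hJiJ : IsFrame (Pc (nb (nb x t₂) (-(Jstep Pc nb ⟨x, t₁, t₂, U⟩).t₂)))
      (JinvStep Pc nb (Jstep Pc nb ⟨x, t₁, t₂, U⟩)).t₁ (JinvStep Pc nb (Jstep Pc nb ⟨x, t₁, t₂, U⟩)).t₂
      (JinvStep Pc nb (Jstep Pc nb ⟨x, t₁, t₂, U⟩)).U)
    (hIiJ : IsFrame (Pc (nb (nb x t₂) (-(Jstep Pc nb ⟨x, t₁, t₂, U⟩).t₁)))
      (IinvStep Pc nb (Jstep Pc nb ⟨x, t₁, t₂, U⟩)).t₁ (IinvStep Pc nb (Jstep Pc nb ⟨x, t₁, t₂, U⟩)).t₂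
      (IinvStep Pc nb (Jstep Pc nb ⟨x, t₁, t₂, U⟩)).U)
    (hcomm : Istep Pc nb (Jstep Pc nb ⟨x, t₁, t₂, U⟩) = Jstep Pc nb (Istep Pc nb ⟨x, t₁, t₂, U⟩)) :
    VinvStep Pc nb (Jstep Pc nb ⟨x, t₁, t₂, U⟩) = Jstep Pc nb (VinvStep Pc nb ⟨x, t₁, t₂, U⟩) := by
  have hPx := pattern_cases hch hx
  have hU' : IsFrame (Pc x) t₂ t₁ U := isFrame_swap hU
  obtain ⟨hI', hJ', hIi', hJi'⟩ := swap_hyps (Pc := Pc) (nb := nb) hI hJ hIi hJi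
  have hII' : IsFrame (Pc (nb (nb x t₂) (Istep Pc nb ⟨x, t₂, t₁, U⟩).t₁))
      (Istep Pc nb (Istep Pc nb ⟨x, t₂, t₁, U⟩)).t₁ (Istep Pc nb (Istep Pc nb ⟨x, t₂, t₁, U⟩)).t₂
      (Istep Pc nb (Istep Pc nb ⟨x, t₂, t₁, U⟩)).U := by
    rw [Istep_swap x t₁ t₂ U, Istep_swap' (Jstep Pc nb ⟨x, t₁, t₂, U⟩)]
    exact isFrame_swap hJJ
  have hJI' : IsFrame (Pc (nb (nb x t₂) (Istep Pc nb ⟨x, t₂, t₁, U⟩).t₂))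
      (Jstep Pc nb (Istep Pc nb ⟨x, t₂, t₁, U⟩)).t₁ (Jstep Pc nb (Istep Pc nb ⟨x, t₂, t₁, U⟩)).t₂
      (Jstep Pc nb (Istep Pc nb ⟨x, t₂, t₁, U⟩)).U := by
    rw [Istep_swap x t₁ t₂ U, Jstep_swap' (Jstep Pc nb ⟨x, t₁, t₂, U⟩)]
    exact isFrame_swap hIJ
  have hIiI' : IsFrame (Pc (nb (nb x t₂) (-(Istep Pc nb ⟨x, t₂, t₁, U⟩).t₁)))
      (IinvStep Pc nb (Istep Pc nb ⟨x, t₂, t₁, U⟩)).t₁ (IinvStep Pc nb (Istep Pc nb ⟨x, t₂, t₁, U⟩)).t₂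
      (IinvStep Pc nb (Istep Pc nb ⟨x, t₂, t₁, U⟩)).U := by
    rw [Istep_swap x t₁ t₂ U, IinvStep_swap' (Jstep Pc nb ⟨x, t₁, t₂, U⟩)]
    exact isFrame_swap hJiJ
  have hJiI' : IsFrame (Pc (nb (nb x t₂) (-(Istep Pc nb ⟨x, t₂, t₁, U⟩).t₂)))
      (JinvStep Pc nb (Istep Pc nb ⟨x, t₂, t₁, U⟩)).t₁ (JinvStep Pc nb (Istep Pc nb ⟨x, t₂, t₁, U⟩)).t₂
      (JinvStep Pc nb (Istep Pc nb ⟨x, t₂, t₁, U⟩)).U := by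
    rw [Istep_swap x t₁ t₂ U, JinvStep_swap' (Jstep Pc nb ⟨x, t₁, t₂, U⟩)]
    exact isFrame_swap hIiJ
  have hcomm' : Istep Pc nb (Jstep Pc nb ⟨x, t₂, t₁, U⟩) = Jstep Pc nb (Istep Pc nb ⟨x, t₂, t₁, U⟩) := by
    rw [Jstep_swap x t₂ t₁ U, Istep_swap x t₁ t₂ U, Istep_swap' (Istep Pc nb ⟨x, t₁, t₂, U⟩),
      Jstep_swap' (Jstep Pc nb ⟨x, t₁, t₂, U⟩), hcomm]
  have key := VinvStep_Istep_comm hch hsy hx hU' hI' hJ' hIi' hJi' hII' hJI' hIiI' hJiI' hcomm'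
  have hregJ := hregJ_of_valid (Pc := Pc) (nb := nb) hJ
  obtain ⟨hyJS, -, -, -, -, -, -, -, -, -, -, hJframe, -⟩ := Jstep_spec hch hsy hx hU hregJ
  have hPyJ := pattern_cases hch hyJS
  obtain ⟨-, hdS, -, -, -, hframeVi, -⟩ := VinvStep_spec hch hsy hx hU hI hJ hIi hJi
  have hPd := pattern_cases hch hdS
  rw [Istep_swap x t₁ t₂ U, VinvStep_swap hPx hU] at key
  rw [VinvStep_swap' (f := Jstep Pc nb ⟨x, t₁, t₂, U⟩) hPyJ hJframe] at key
  rw [Istep_swap' (Pc := Pc) (nb := nb) (VinvStep Pc nb ⟨x, t₁, t₂, U⟩)] at key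
  obtain ⟨h1, h2, h3, h4⟩ := ZFrame.mk.inj key
  exact ZFrame.ext' h1 h3 h2 h4

/-! ## Anchor -/

/-- Anchor (registered sub-goal of stmt-AtomisticToContinuum-12088, toward `develop_transport`):
`V⁻¹ ∘ I = I ∘ V⁻¹` on valid frames with valid layer neighbourhood commuting with the in-layer
steps (explicit form of `VinvStep_Istep_comm`). [folklore] -/
theorem transportVComm3_anchor : ∀ (S : Set (EuclideanSpace ℝ (Fin 3))) (Pc : EuclideanSpace ℝ (Fin 3) → Finset (Fin 3 → ℤ)) (Ac : EuclideanSpace ℝ (Fin 3) → (EuclideanSpace ℝ (Fin 3) →ₗᵢ[ℝ] EuclideanSpace ℝ (Fin 3))) (nb : EuclideanSpace ℝ (Fin 3) → (Fin 3 → ℤ) → EuclideanSpace ℝ (Fin 3)), (∀ z ∈ S, IsZChart S z (Pc z) (Ac z) (nb z)) → (∀ x ∈ S, ∀ y ∈ shell S x, x ∈ shell S y) → ∀ x ∈ S, ∀ (t₁ t₂ : Fin 3 → ℤ) (U : Finset (Fin 3 → ℤ)), IsFrame (Pc x) t₁ t₂ U → IsFrame (Pc (nb x t₁)) (Istep Pc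 nb ⟨x, t₁, t₂, U⟩).t₁ (Istep Pc nb ⟨x, t₁, t₂, U⟩).t₂ (Istep Pc nb ⟨x, t₁, t₂, U⟩).U → IsFrame (Pc (nb x t₂)) (Jstep Pc nb ⟨x, t₁, t₂, U⟩).t₁ (Jstep Pc nb ⟨x, t₁, t₂, U⟩).t₂ (Jstep Pc nb ⟨x, t₁, t₂, U⟩).U → IsFrame (Pc (nb x (-t₁))) (IinvStep Pc nb ⟨x, t₁, t₂, U⟩).t₁ (IinvStep Pc nb ⟨x, t₁, t₂, U⟩).t₂ (IinvStep Pc nb ⟨x, t₁, t₂, U⟩).U → IsFrame (Pc (nb x (-t₂))) (JinvStep Pc nb ⟨x, t₁, t₂, U⟩).t₁ (JinvStep Pc nb ⟨x, t₁, t₂, U⟩).t₂ (JinvStep Pc nb ⟨x, t₁, t₂, U⟩).U → IsFrame (Pc (nb (nb x t₁) (Istep Pc nb ⟨x, t₁, t₂, U⟩).t₁)) (Istep Pc nb (Istep Pc nb ⟨x, t₁, t₂, U⟩)).t₁ (Istep Pc nb (Istep Pc nb ⟨x, t₁, t₂, U⟩)).t₂ (Istep Pc nb (Istep Pc nb ⟨x,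 t₁, t₂, U⟩)).U → IsFrame (Pc (nb (nb x t₁) (Istep Pc nb ⟨x, t₁, t₂, U⟩).t₂)) (Jstep Pc nb (Istep Pc nb ⟨x, t₁, t₂, U⟩)).t₁ (Jstep Pc nb (Istep Pc nb ⟨x, t₁, t₂, U⟩)).t₂ (Jstep Pc nb (Istep Pc nb ⟨x, t₁, t₂, U⟩)).U → IsFrame (Pc (nb (nb x t₁) (-(Istep Pc nb ⟨x, t₁, t₂, U⟩).t₁))) (IinvStep Pc nb (Istep Pc nb ⟨x, t₁, t₂, U⟩)).t₁ (IinvStep Pc nb (Istep Pc nb ⟨x, t₁, t₂, U⟩)).t₂ (IinvStep Pc nb (Istep Pc nb ⟨x, t₁, t₂, U⟩)).U → IsFrame (Pc (nb (nb x t₁) (-(Istep Pc nb ⟨x, t₁, t₂, U⟩).t₂))) (JinvStep Pc nb (Istep Pc nb ⟨x, t₁, t₂, U⟩)).t₁ (JinvStep Pc nb (Istep Pc nb ⟨x, t₁, t₂, U⟩)).t₂ (JinvStep Pc nb (Istep Pc nb ⟨x, t₁, t₂, U⟩)).U → Istep Pc nb (Jstep Pc nb ⟨x, t₁, t₂, U⟩)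 = Jstep Pc nb (Istep Pc nb ⟨x, t₁, t₂, U⟩) → VinvStep Pc nb (Istep Pc nb ⟨x, t₁, t₂, U⟩) = Istep Pc nb (VinvStep Pc nb ⟨x, t₁, t₂, U⟩) :=
  fun _ _ _ _ hch hsy _ hx _ _ _ hU hI hJ hIi hJi hII hJI hIiI hJiI hcomm =>
    VinvStep_Istep_comm hch hsy hx hU hI hJ hIi hJi hII hJI hIiI hJiI hcomm

end Summit.AtomisticToContinuum.Crystallization.Theorems.HullExactificationCascadeRobustBarlowTemplate

end
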